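import Summits.QuantumFields.BalabanUV.Beta.GAN24.OneStepConstraintLettersReg
import Summits.QuantumFields.BalabanUV.Beta.GAN24.DerivativeRateTransferLoewnerGramMass

/-!
# `BalabanUV.Beta.GAN24.StackedConstraintLetters` — binder row G-an2-4 ∕ (CONV-C), routes C-R6° («VALUES») × R7 («TWO CURRENCIES»), PART 177:
# GENERIC LETTERS OF A STACKED CONSTRAINT `fromRows Q E` — kernel = `ker Q ∩ ker E`, kernel coercivity on the intersection IS PART 169 ∕ 170's `hker` for the stacked matrix,
# a right inverse with mass bound from right inverses of the two blocks, the coordinate projection onto a set of bonds and its zero-extension, and PART 169's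
# `coercive_reg_of_ker` for the stacked regulariser — the option-independent half of census V200 («Q̃ ↦ fromRows Q̃ E», E = the axial tree bonds)
# (unit b2b-balaban-gan24-p3, gen 59; v1)

NOT IN PRINT; OUR PROOF ([folklore] finite-dimensional linear algebra; Mathlib's `Matrix.fromRows`; PART 169 `OneStepConstraintLettersReg.coercive_reg_of_ker` and road P3's `DerivativeRateTransferLoewnerGramMass.dotProduct_self_add_le_two_mul` BY NAME).
[Balaban1984PropagatorsII] (2.121) p. 244 (the axial gauge «B(Γ_{y,x}) = 0»), (2.152)–(2.157) pp. 249–250 (the k+1 step integrates with `δ(Q̃B)δ_{Ax}(B)`; `C(C*Δ_kC)⁻¹C*`) LOCATE why the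
one-loop step's constraint is the PAIR (averaging, axial gauge); nothing printed is a hypothesis.)
HONEST FRAMING (cell contract, verbatim): «discharging `BetaPertH` makes Bałaban's UV stability UNCONDITIONAL — a real constructive-QFT result; it is NOT the continuum limit
and NOT the Clay problem.»  HONEST DEPENDENCY (verbatim): «continuum YM on T⁴ ⇐ BetaPertH ∧ nine spine estimates (0/9 proved); BetaPertH ⇐ (D1) ∧ (D4) ∧ CAP+tail; G-an2-4 gates
asym, D1 and NE2/3/4.»

WHY (census V200, gen 59).  PARTs 175–176: the lineage's `Σ_k` is exactly gauge invariant, so an2's `flucCov(Σ_k, Q̃)` is undefined, while (2.153) (`EffectiveFormDelK.lower2153_effForm`) makes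
`Σ_k` coercive on `ker Q̃ ∩ {axial}`.  Since `CompositionSingular.flucCov H Q := ((kkt H Q)⁻¹)₁₁` takes ANY constraint matrix, the repair of census V195 ∕ V196 is the STACKED constraint
`Matrix.fromRows Q̃ E`, `E` the coordinate projection onto the tree bonds; Bałaban's `C(CᵀHC)⁻¹Cᵀ` is `flucCov H (fromRows Q̃ E)`.  Every letters-in ∕ ENDs-out file of the lineage
(PARTs 105–107, 113–114, 164–167, 169–173) then applies verbatim once the LETTERS of the stacked constraint are supplied; THIS FILE supplies the generic ones.

WHAT THIS FILE PROVES (0 sorry, 0 `def`; `c, T, ν` finite index types):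
* §1 **`fromRows_mulVec_eq_zero_iff`** (`fromRows Q E · v = 0 ↔ Q v = 0 ∧ E v = 0`, any semiring), **`ker_coercive_fromRows`** (real, PART 169 ∕ 170's `hker` shape) and
  **`ker_coerciveC_fromRows`** (complex, PART 173's `hkerC` shape): coercivity on `ker Q ∩ ker E` is coercivity on `ker (fromRows Q E)`.
* §2 `dotProduct_self_sum_elim` (`|D|² = |D∘inl|² + |D∘inr|²`), **`fromRows_mulVec_stackedLift`** and **`stackedLift_mass`**: from a
  right inverse `R_Q` of `Q` KILLED BY `E` (`E(R_Q B) = 0` — for Bałaban's averaging the corner lift, whose bond is not a tree bond) and a right inverse `R_E` of `E`, the stacked datum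
  `D = (B, w)` is lifted by `u = R_Q(B − Q R_E w) + R_E w` with `fromRows Q E · u = D` and `|u|² ≤ (4e_Q(1+q) + 2e_E)|D|²`.
* §3 the COORDINATE PROJECTION onto an embedded family of bonds `ι : T ↪ ν` (spelled inline: `E t x = [x = ι t]`, zero-extension `ext w x = Σ_t [x = ι t] w t`): `proj_mulVec`
  (`E v = v ∘ ι`), `ext_apply_embed` ∕ `ext_apply_of_not_range`, **`proj_mulVec_ext`** (`E(ext w) = w`), **`ext_dotProduct_self`** (`|ext w|² = |w|²`), `sum_abs_proj_row` (row mass `1`).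
* §4 **`coercive_reg_fromRows`** — PART 169's `coercive_reg_of_ker` for the stacked regulariser `H + (fromRows Q E)ᵀ(a•1)(fromRows Q E)`, constant
  `(max (4∕γ₀) ((4h·e₂∕γ₀ + 2e₂)∕a))⁻¹` with `e₂ = 4e_Q(1+q) + 2e_E`, from coercivity of `H` on `ker Q ∩ ker E` alone.
WHAT IT IS NOT: the model-specific letters (which bonds are tree bonds in `par ∕ rem` words; that the corner lift avoids them; (2.153) transported to this shape; PART 105's
pseudo-distance on `c ⊕ T`) are the adapter's (census V200 (α)–(γ)); no decay statement here.  SUPPLIER work; NEVER «G-an2-4 closed»; NOT (CONV-C), NOT D1, NOT `BetaPertH`, NOT continuum,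
NOT Clay.  Records: `HOME/b2b-balaban-gan24-p3/gen59/README.md`.
-/

noncomputable section

open scoped BigOperators Matrix
open Finset Matrix

namespace Summit.QuantumFields.BalabanUV.Beta.GAN24.StackedConstraintLetters

open Literature.MathematicalPhysics.QuantumFieldTheory.Balaban1983to89
open Literature.MathematicalPhysics.QuantumFieldTheory.Balaban1983to89.B5Prop11Lower (nsq)
open Summit.QuantumFields.BalabanUV.Beta.GAN24.OneStepConstraintLettersReg (coercive_reg_of_ker)
open Summit.QuantumFields.BalabanUV.Beta.GAN24.DerivativeRateTransferLoewnerGramMass (dotProduct_self_add_le_two_mul)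

/-! ## §1 The kernel of a stacked constraint and coercivity on it -/

section Kernel

variable {c T ν : Type*} [Fintype ν]

/-- **`fromRows_mulVec_eq_zero_iff`**: `fromRows Q E · v = 0 ↔ Q·v = 0 ∧ E·v = 0`. [folklore] -/
theorem fromRows_mulVec_eq_zero_iff {R : Type*} [NonUnitalNonAssocSemiring R] (Q : Matrix c ν R) (E : Matrix T ν R) (v : ν → R) :
    Matrix.fromRows Q E *ᵥ v = 0 ↔ Q *ᵥ v = 0 ∧ E *ᵥ v = 0 := by
  constructor
  · intro h
    exact ⟨funext fun i => congrFun h (Sum.inl i), funext fun t => congrFun h (Sum.inr t)⟩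
  · rintro ⟨h1, h2⟩
    funext i
    cases i with
    | inl i => exact congrFun h1 i
    | inr t => exact congrFun h2 t

/-- **`ker_coercive_fromRows`** — coercivity of a real form on `ker Q ∩ ker E` IS PART 169 ∕ 170's letter `hker` for the stacked constraint `fromRows Q E`. [folklore] -/
theorem ker_coercive_fromRows {H : Matrix ν ν ℝ} {Q : Matrix c ν ℝ} {E : Matrix T ν ℝ} {γ₀ : ℝ}
    (hker : ∀ z : ν → ℝ, Q *ᵥ z = 0 → E *ᵥ z = 0 → γ₀ * (z ⬝ᵥ z) ≤ z ⬝ᵥ (H *ᵥ z))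
    (z : ν → ℝ) (hz : Matrix.fromRows Q E *ᵥ z = 0) : γ₀ * (z ⬝ᵥ z) ≤ z ⬝ᵥ (H *ᵥ z) :=
  hker z ((fromRows_mulVec_eq_zero_iff Q E z).mp hz).1 ((fromRows_mulVec_eq_zero_iff Q E z).mp hz).2

/-- **`ker_coerciveC_fromRows`** — the same in the `ℂ` currency (PART 173's letter `hkerC` for the stacked constraint). [folklore] -/
theorem ker_coerciveC_fromRows {A : Matrix ν ν ℂ} {Q : Matrix c ν ℂ} {E : Matrix T ν ℂ} {γ₀ : ℝ}
    (hker : ∀ v : ν → ℂ, Q *ᵥ v = 0 → E *ᵥ v = 0 → γ₀ * nsq v ≤ (star v ⬝ᵥ (A *ᵥ v)).re)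
    (v : ν → ℂ) (hv : Matrix.fromRows Q E *ᵥ v = 0) : γ₀ * nsq v ≤ (star v ⬝ᵥ (A *ᵥ v)).re :=
  hker v ((fromRows_mulVec_eq_zero_iff Q E v).mp hv).1 ((fromRows_mulVec_eq_zero_iff Q E v).mp hv).2

end Kernel

/-! ## §2 A right inverse of the stacked constraint from right inverses of the blocks -/

section Lift

variable {c T ν : Type*} [Fintype c] [Fintype T] [Fintype ν]

omit [Fintype ν] in
/-- `|D|² = |D ∘ inl|² + |D ∘ inr|²` for a datum on `c ⊕ T`. [folklore] -/
theorem dotProduct_self_sum_elim (D : c ⊕ T → ℝ) : D ⬝ᵥ D = (D ∘ Sum.inl) ⬝ᵥ (D ∘ Sum.inl) + (D ∘ Sum.inr) ⬝ᵥ (D ∘ Sum.inr) := by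
  simp only [dotProduct, Fintype.sum_sum_type, Function.comp]

omit [Fintype c] [Fintype T] in
/-- **`fromRows_mulVec_stackedLift` — THE STACKED LIFT IS A RIGHT INVERSE**: with `Q(R_Q B) = B`, `E(R_Q B) = 0`, `E(R_E w) = w`, the field `u = R_Q(B − Q(R_E w)) + R_E w` has
`Q u = B` and `E u = w`. [folklore] -/
theorem fromRows_mulVec_stackedLift {Q : Matrix c ν ℝ} {E : Matrix T ν ℝ} {RQ : (c → ℝ) → (ν → ℝ)} {RE : (T → ℝ) → (ν → ℝ)}
    (hQR : ∀ B, Q *ᵥ RQ B = B) (hER : ∀ B, E *ᵥ RQ B = 0) (hEE : ∀ w, E *ᵥ RE w = w) (D : c ⊕ T → ℝ) :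
    Matrix.fromRows Q E *ᵥ (RQ (D ∘ Sum.inl - Q *ᵥ RE (D ∘ Sum.inr)) + RE (D ∘ Sum.inr)) = D := by
  have hQ : Q *ᵥ (RQ (D ∘ Sum.inl - Q *ᵥ RE (D ∘ Sum.inr)) + RE (D ∘ Sum.inr)) = D ∘ Sum.inl := by
    rw [Matrix.mulVec_add, hQR, sub_add_cancel]
  have hE : E *ᵥ (RQ (D ∘ Sum.inl - Q *ᵥ RE (D ∘ Sum.inr)) + RE (D ∘ Sum.inr)) = D ∘ Sum.inr := by
    rw [Matrix.mulVec_add, hER, hEE, zero_add]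
  funext i
  cases i with
  | inl i => exact (congrFun hQ i : _)
  | inr t => exact (congrFun hE t : _)

/-- **`stackedLift_mass` — ITS MASS**: `|R_Q B|² ≤ e_Q|B|²`, `|R_E w|² ≤ e_E|w|²`, `|Q(R_E w)|² ≤ q|w|²` (`e_Q, e_E, q ≥ 0`) give `|u|² ≤ (4e_Q(1+q) + 2e_E)·|D|²`. [folklore] -/
theorem stackedLift_mass {Q : Matrix c ν ℝ} {RQ : (c → ℝ) → (ν → ℝ)} {RE : (T → ℝ) → (ν → ℝ)} {eQ eE q : ℝ} (heQ : 0 ≤ eQ) (heE : 0 ≤ eE) (hq : 0 ≤ q)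
    (hRQ : ∀ B, RQ B ⬝ᵥ RQ B ≤ eQ * (B ⬝ᵥ B)) (hRE : ∀ w, RE w ⬝ᵥ RE w ≤ eE * (w ⬝ᵥ w)) (hQRE : ∀ w, (Q *ᵥ RE w) ⬝ᵥ (Q *ᵥ RE w) ≤ q * (w ⬝ᵥ w))
    (D : c ⊕ T → ℝ) :
    (RQ (D ∘ Sum.inl - Q *ᵥ RE (D ∘ Sum.inr)) + RE (D ∘ Sum.inr)) ⬝ᵥ (RQ (D ∘ Sum.inl - Q *ᵥ RE (D ∘ Sum.inr)) + RE (D ∘ Sum.inr))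
      ≤ (4 * eQ * (1 + q) + 2 * eE) * (D ⬝ᵥ D) := by
  set B : c → ℝ := D ∘ Sum.inl with hB
  set w : T → ℝ := D ∘ Sum.inr with hw
  have hD : D ⬝ᵥ D = B ⬝ᵥ B + w ⬝ᵥ w := dotProduct_self_sum_elim D
  have hB0 : 0 ≤ B ⬝ᵥ B := by rw [dotProduct]; exact Finset.sum_nonneg fun i _ => mul_self_nonneg _
  have hw0 : 0 ≤ w ⬝ᵥ w := by rw [dotProduct]; exact Finset.sum_nonneg fun i _ => mul_self_nonneg _
  have h1 := dotProduct_self_add_le_two_mul (RQ (B - Q *ᵥ RE w)) (RE w)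
  have h2 : RQ (B - Q *ᵥ RE w) ⬝ᵥ RQ (B - Q *ᵥ RE w) ≤ eQ * (2 * (B ⬝ᵥ B) + 2 * (q * (w ⬝ᵥ w))) := by
    refine (hRQ _).trans (mul_le_mul_of_nonneg_left ?_ heQ)
    have h3 := dotProduct_self_add_le_two_mul B (-(Q *ᵥ RE w))
    rw [← sub_eq_add_neg, neg_dotProduct, dotProduct_neg, neg_neg] at h3
    exact h3.trans (by nlinarith [hQRE w])
  have h4 := hRE w
  rw [hD]
  have h5 : (RQ (B - Q *ᵥ RE w) + RE w) ⬝ᵥ (RQ (B - Q *ᵥ RE w) + RE w)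
      ≤ 4 * eQ * (B ⬝ᵥ B) + 4 * eQ * q * (w ⬝ᵥ w) + 2 * eE * (w ⬝ᵥ w) := by nlinarith [h1, h2, h4]
  have h6 : 0 ≤ 4 * eQ * q * (B ⬝ᵥ B) + 2 * eE * (B ⬝ᵥ B) + 4 * eQ * (w ⬝ᵥ w) := by positivity
  nlinarith [h5, h6]

end Lift

/-! ## §3 The coordinate projection onto an embedded family of bonds and its zero-extension -/

section Projection

variable {T ν : Type*} [Fintype T] [Fintype ν] [DecidableEq ν] [DecidableEq T]

omit [Fintype T] [DecidableEq T] in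
/-- `E v = v ∘ ι` for the coordinate projection `E t x = [x = ι t]`. [folklore] -/
theorem proj_mulVec (ι : T ↪ ν) (v : ν → ℝ) (t : T) :
    ((fun (t : T) (x : ν) => if x = ι t then (1 : ℝ) else 0) *ᵥ v) t = v (ι t) := by
  simp only [Matrix.mulVec, dotProduct, ite_mul, one_mul, zero_mul, Finset.sum_ite_eq', Finset.mem_univ, if_true]

omit [Fintype ν] [DecidableEq T] in
/-- the zero-extension `ext w x = Σ_t [x = ι t]·w t` takes the value `w t` on the bond `ι t` … [folklore] -/
theorem ext_apply_embed (ι : T ↪ ν) (w : T → ℝ) (t : T) :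
    (∑ t' : T, if ι t = ι t' then w t' else 0) = w t := by
  rw [Finset.sum_eq_single t, if_pos rfl]
  · intro t' _ ht'
    rw [if_neg]
    exact fun h => ht' (ι.injective h).symm
  · intro h; exact absurd (Finset.mem_univ t) h

omit [Fintype ν] [DecidableEq T] in
/-- … and `0` off the family. [folklore] -/
theorem ext_apply_of_not_range (ι : T ↪ ν) (w : T → ℝ) {x : ν} (hx : ∀ t, x ≠ ι t) :
    (∑ t' : T, if x = ι t' then w t' else 0) = 0 :=
  Finset.sum_eq_zero fun t' _ => if_neg (hx t')

omit [DecidableEq T] in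
/-- **`proj_mulVec_ext` — THE ZERO-EXTENSION IS A RIGHT INVERSE OF THE PROJECTION**: `E(ext w) = w`. [folklore] -/
theorem proj_mulVec_ext (ι : T ↪ ν) (w : T → ℝ) :
    (fun (t : T) (x : ν) => if x = ι t then (1 : ℝ) else 0) *ᵥ (fun x => ∑ t' : T, if x = ι t' then w t' else 0) = w := by
  funext t
  rw [proj_mulVec, ext_apply_embed]

omit [DecidableEq T] in
/-- **`ext_dotProduct_self` — THE MASS OF THE ZERO-EXTENSION**: `|ext w|² = |w|²` (the bonds `ι t` are distinct). [folklore] -/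
theorem ext_dotProduct_self (ι : T ↪ ν) (w : T → ℝ) :
    (fun x => ∑ t' : T, if x = ι t' then w t' else 0) ⬝ᵥ (fun x => ∑ t' : T, if x = ι t' then w t' else 0) = w ⬝ᵥ w := by
  -- `(ext w)(x)² = Σ_t [x = ι t]·w t²` pointwise (at most one bond of the family at `x`)
  have hpt : ∀ x : ν, (∑ t' : T, if x = ι t' then w t' else 0) * (∑ t' : T, if x = ι t' then w t' else 0)
      = ∑ t' : T, if x = ι t' then w t' * w t' else 0 := by
    intro x
    by_cases hx : ∃ t, x = ι t
    · obtain ⟨t, rfl⟩ := hx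
      rw [ext_apply_embed, ext_apply_embed ι (fun t' => w t' * w t') t]
    · have hx' : ∀ t, x ≠ ι t := fun t h => hx ⟨t, h⟩
      rw [ext_apply_of_not_range ι w hx', zero_mul]
      exact (Finset.sum_eq_zero fun t' _ => if_neg (hx' t')).symm
  simp only [dotProduct, hpt]
  rw [Finset.sum_comm]
  refine Finset.sum_congr rfl fun t _ => ?_
  rw [Finset.sum_ite_eq' Finset.univ (ι t)]
  simp

omit [Fintype T] [DecidableEq T] in
/-- row mass `1`: `Σ_x |E t x| = 1` (PART 105's `q₁`-type letter for the tree rows). [folklore] -/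
theorem sum_abs_proj_row (ι : T ↪ ν) (t : T) : ∑ x : ν, |(fun (t : T) (x : ν) => if x = ι t then (1 : ℝ) else 0) t x| = 1 := by
  simp only [apply_ite abs, abs_one, abs_zero, Finset.sum_ite_eq', Finset.mem_univ, if_true]

end Projection

/-! ## §4 PART 169's regularised coercivity for the stacked constraint -/

section Reg

variable {c T ν : Type*} [Fintype c] [Fintype T] [Fintype ν] [DecidableEq c] [DecidableEq T]

/-- **`coercive_reg_fromRows` — KERNEL COERCIVITY ON `ker Q ∩ ker E` ⟹ COERCIVITY OF THE STACKED REGULARISED FORM**: `H` symmetric, `0 ≤ ⟨u,Hu⟩ ≤ h|u|²`, `γ₀`-coercive on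
`ker Q ∩ ker E`, right inverses `R_Q` (killed by `E`) and `R_E` with masses `e_Q, e_E` and `|Q R_E w|² ≤ q|w|²`; then for `a > 0`
`QGQInverse.Coercive (H + (fromRows Q E)ᵀ(a•1)(fromRows Q E)) (max (4∕γ₀) ((4h·e₂∕γ₀ + 2e₂)∕a))⁻¹`, `e₂ = 4e_Q(1+q) + 2e_E` (PART 169 `coercive_reg_of_ker` with the stacked lift).
[folklore] -/
theorem coercive_reg_fromRows {H : Matrix ν ν ℝ} (hH : Hᵀ = H) (hpsd : ∀ z : ν → ℝ, 0 ≤ z ⬝ᵥ (H *ᵥ z)) {h : ℝ} (hh : 0 ≤ h)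
    (hHub : ∀ u : ν → ℝ, u ⬝ᵥ (H *ᵥ u) ≤ h * (u ⬝ᵥ u))
    {Q : Matrix c ν ℝ} {E : Matrix T ν ℝ} {γ₀ : ℝ} (hγ₀ : 0 < γ₀)
    (hker : ∀ z : ν → ℝ, Q *ᵥ z = 0 → E *ᵥ z = 0 → γ₀ * (z ⬝ᵥ z) ≤ z ⬝ᵥ (H *ᵥ z))
    {RQ : (c → ℝ) → (ν → ℝ)} {RE : (T → ℝ) → (ν → ℝ)} {eQ eE q : ℝ} (heQ : 0 ≤ eQ) (heE : 0 ≤ eE) (hq : 0 ≤ q)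
    (hQR : ∀ B, Q *ᵥ RQ B = B) (hER : ∀ B, E *ᵥ RQ B = 0) (hEE : ∀ w, E *ᵥ RE w = w)
    (hRQ : ∀ B, RQ B ⬝ᵥ RQ B ≤ eQ * (B ⬝ᵥ B)) (hRE : ∀ w, RE w ⬝ᵥ RE w ≤ eE * (w ⬝ᵥ w)) (hQRE : ∀ w, (Q *ᵥ RE w) ⬝ᵥ (Q *ᵥ RE w) ≤ q * (w ⬝ᵥ w))
    {a : ℝ} (ha : 0 < a) :
    QGQInverse.Coercive (H + (Matrix.fromRows Q E)ᵀ * (a • (1 : Matrix (c ⊕ T) (c ⊕ T) ℝ)) * Matrix.fromRows Q E)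
      (max (4 / γ₀) ((4 * h * (4 * eQ * (1 + q) + 2 * eE) / γ₀ + 2 * (4 * eQ * (1 + q) + 2 * eE)) / a))⁻¹ :=
  coercive_reg_of_ker hH hpsd hh hHub hγ₀ (ker_coercive_fromRows hker)
    (E := fun D => RQ (D ∘ Sum.inl - Q *ᵥ RE (D ∘ Sum.inr)) + RE (D ∘ Sum.inr))
    (fromRows_mulVec_stackedLift hQR hER hEE) (stackedLift_mass heQ heE hq hRQ hRE hQRE) ha

end Reg

end Summit.QuantumFields.BalabanUV.Beta.GAN24.StackedConstraintLetters

end
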